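import Literature.MathematicalPhysics.KineticTheory.HardSphereCanonicalKSLimit
import HarnessLib

/-!
# Two-cluster factorisation of the canonical hard-sphere correlation functions: the one-step estimate

Topic `Literature/MathematicalPhysics/KineticTheory` (companion of `HardSphereCanonicalKSLimit`).
For `N + 1` hard spheres of diameter `ε_N = σ (N+1)^{-1/3}` on `𝕋³` at small reduced density `σ`
and the normalised pinned probabilities `v_n = vcan ε_N n` of `HardSphereCanonicalKSLimit`, we run
Ruelle's Kirkwood–Salsburg contraction (canonical, periodic version: `ksInv_step`) for the
TWO-CLUSTER comparison

  `|v_n(Y ++ Y') − g_k(lift_c Y) · g_{k'}(lift_{c'} Y')| ≤ b 4^{k+k'}`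

of a configuration made of a cluster `Y` (within `r` of a centre `c`) and a far-away cluster `Y'`
(within `r'` of `c'`, `d(c, c') ≥ D`) with the PRODUCT of the infinite-volume correlation functions
`g = gLim σ`: peeling the first point of `Y` by the canonical Kirkwood–Salsburg identity
(`vcan_cons`) reproduces the fixed-point equation of `g_k` (`gLim_succ`) times the constant
`g_{k'}(lift Y')`, the second cluster riding along (the wall factor of the peeled point against `Y'`
is `1` by separation), with the same coefficient errors `etaErr` and the same contraction ratio
`θ₀`; the base case `k = 0` is the one-cluster invariant `KSInv` at the same level (`ksInv2_step`).
The iteration and the thermodynamic limit are in `HardSphereCanonicalTwoClusterLimit`.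

## References

* D. Ruelle, *Statistical Mechanics: Rigorous Results* (1969), §4.2.2–4.2.3, Thm 4.2.3.  [Ruelle1969]
* E. Pulvirenti, D. Tsagkarogiannis, Comm. Math. Phys. 316 (2012) 289–306, Thm 2.1, §5.
  [PulvirentiTsagkarogiannis2012]
-/

noncomputable section

open MeasureTheory Set Filter Function Metric
open scoped ENNReal BigOperators Topology Classical

namespace Literature.MathematicalPhysics.KineticTheory

open StatisticalMechanics Literature.Analysis.FluidPDE Literature.Analysis.FunctionSpaces

/-! ### Relabelling the pinned points -/

/-- Relabelling invariance of `v_n`: `v_n(y ∘ e) = v_n(y)` for every bijection `e` of labels.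
[folklore] -/
theorem vcan_comp_equiv (ε : ℝ) (n : ℕ) {k k' : ℕ} (e : Fin k' ≃ Fin k) (y : Fin k → T3) :
    vcan ε n (y ∘ e) = vcan ε n y := by
  have hk : k' = k := by simpa using Fintype.card_congr e
  unfold vcan
  rw [pinnedXi_comp_equiv]
  subst hk
  rfl

/-- Relabelling invariance of `v_n` along `Fin.cast`. [folklore] -/
theorem vcan_comp_cast (ε : ℝ) (n : ℕ) {k k' : ℕ} (h : k' = k) (y : Fin k → T3) :
    vcan ε n (y ∘ Fin.cast h) = vcan ε n y :=
  vcan_comp_equiv ε n (finCongr h) y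

/-- `v_n((y₁ :: Y) ++ Y') = v_n(y₁ :: (Y ++ Y'))`. [folklore] -/
theorem vcan_append_cons (ε : ℝ) (n : ℕ) {k k' : ℕ} (y₁ : T3) (Y : Fin k → T3) (Y' : Fin k' → T3) :
    vcan ε n (Fin.append (Fin.cons y₁ Y) Y') =
      vcan ε n (Fin.cons y₁ (Fin.append Y Y') : Fin (k + k' + 1) → T3) := by
  rw [Fin.append_cons, vcan_comp_cast]

/-- Swapping two appended blocks: `Y' ++ z = (z ++ Y') ∘ finAddFlip`. [folklore] -/
theorem append_eq_append_comp_finAddFlip {α : Type*} {k j : ℕ} (Y' : Fin k → α) (z : Fin j → α) :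
    Fin.append Y' z = Fin.append z Y' ∘ finAddFlip := by
  funext i
  refine Fin.addCases (fun a => ?_) (fun b => ?_) i
  · rw [Fin.append_left, comp_apply, finAddFlip_apply_castAdd, Fin.append_right]
  · rw [Fin.append_right, comp_apply, finAddFlip_apply_natAdd, Fin.append_left]

/-- `v_n((Y ++ Y') ++ z) = v_n((Y ++ z) ++ Y')` (same pinned points, relabelled). [folklore] -/
theorem vcan_append_append_swap (ε : ℝ) (n : ℕ) {k k' j : ℕ} (Y : Fin k → T3) (Y' : Fin k' → T3)
    (z : Fin j → T3) :
    vcan ε n (Fin.append (Fin.append Y Y') z) = vcan ε n (Fin.append (Fin.append Y z) Y') := by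
  rw [Fin.append_assoc, vcan_comp_cast, Fin.append_assoc, vcan_comp_cast,
    append_eq_append_comp_finAddFlip Y' z]
  have : Fin.append Y (Fin.append z Y' ∘ ⇑finAddFlip) =
      Fin.append Y (Fin.append z Y') ∘
        (finSumFinEquiv.symm.trans (((Equiv.refl (Fin k)).sumCongr finAddFlip).trans finSumFinEquiv)) := by
    funext i
    refine Fin.addCases (fun a => ?_) (fun b => ?_) i
    · simp [Fin.append_left]
    · simp [Fin.append_right]
  rw [this, vcan_comp_equiv]

/-- `v_n(∅ ++ Y') = v_n(Y')`. [folklore] -/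
theorem vcan_elim0_append (ε : ℝ) (n : ℕ) {k' : ℕ} (Y : Fin 0 → T3) (Y' : Fin k' → T3) :
    vcan ε n (Fin.append Y Y') = vcan ε n Y' := by
  rw [Fin.append_left_nil Y Y' rfl, vcan_comp_cast]

/-- **The wall factor of a separated cluster is trivial**: if `y₁` is at minimal-image distance
`≥ ε` from every point of `Y'`, then `𝟙[y₁ ∼ Y ++ Y'] = 𝟙[y₁ ∼ Y]`. [folklore] -/
theorem wallInd_append_of_le (ε : ℝ) (y₁ : T3) {k k' : ℕ} (Y : Fin k → T3) (Y' : Fin k' → T3)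
    (hsep : ∀ b, ε ≤ Torus.euclidDist y₁ (Y' b)) :
    wallInd ε y₁ (Fin.append Y Y') = wallInd ε y₁ Y := by
  have key : (∀ a, ¬ Ov ε y₁ (Fin.append Y Y' a)) ↔ ∀ a, ¬ Ov ε y₁ (Y a) := by
    constructor
    · intro H a
      have := H (Fin.castAdd k' a)
      rwa [Fin.append_left] at this
    · intro H a
      refine Fin.addCases (fun i => ?_) (fun i => ?_) a
      · rw [Fin.append_left]; exact H i
      · rw [Fin.append_right]; exact not_lt.2 (hsep i)
  simp only [wallInd, key]

/-! ### The two-cluster one-step estimate -/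

section Step

variable {σ : ℝ} (h : SmallDensity uniformProfile σ)
include h

/-- **The a priori two-cluster bound** `|v_n(Y ++ Y') − g_k g_{k'}| ≤ 2^{k+k'} + 3^{k+k'}`
(`n ≤ N + 1`). [cite: Ruelle1969, §4.2.2 (2.15)] -/
theorem abs_vcan_append_sub_mul_le_add {N n : ℕ} (hn : n ≤ N + 1) {k k' : ℕ} (Y : Fin k → T3)
    (Y' : Fin k' → T3) (x : Fin k → E3) (x' : Fin k' → E3) :
    |vcan (hsDiameter σ N) n (Fin.append Y Y') - gLim σ k x * gLim σ k' x'| ≤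
      2 ^ (k + k') + 3 ^ (k + k') := by
  have hg : |gLim σ k x * gLim σ k' x'| ≤ 3 ^ (k + k') := by
    rw [abs_mul, pow_add]
    exact mul_le_mul (abs_gLim_le h k _) (abs_gLim_le h k' _) (abs_nonneg _) (by positivity)
  calc _ ≤ |vcan (hsDiameter σ N) n (Fin.append Y Y')| + |gLim σ k x * gLim σ k' x'| := abs_sub _ _
    _ ≤ 2 ^ (k + k') + 3 ^ (k + k') := add_le_add (abs_vcan_le h hn _) hg

/-- **The trivial two-cluster bound** `|v_n(Y ++ Y') − g_k g_{k'}| ≤ 2 · 4^{k+k'}` (`n ≤ N + 1`).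
[cite: Ruelle1969, §4.2.2 (2.15)] -/
theorem abs_vcan_append_sub_mul_le_two {N n : ℕ} (hn : n ≤ N + 1) {k k' : ℕ} (Y : Fin k → T3)
    (Y' : Fin k' → T3) (x : Fin k → E3) (x' : Fin k' → E3) :
    |vcan (hsDiameter σ N) n (Fin.append Y Y') - gLim σ k x * gLim σ k' x'| ≤ 2 * 4 ^ (k + k') := by
  have h2 : (2 : ℝ) ^ (k + k') ≤ 4 ^ (k + k') := pow_le_pow_left₀ (by norm_num) (by norm_num) _
  have h3 : (3 : ℝ) ^ (k + k') ≤ 4 ^ (k + k') := pow_le_pow_left₀ (by norm_num) (by norm_num) _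
  have := abs_vcan_append_sub_mul_le_add h hn Y Y' x x'
  linarith

/-- **The two-cluster one-step estimate** (Ruelle's contraction, canonical version, a second
cluster riding along): the two-cluster comparison at level `n − 1` (first window `2r`, second
window `r'`, centre separation `D − r`, bound `b`) together with the one-cluster invariant at level
`n` (window `r'`) imply the two-cluster comparison at level `n`, first window `r`, separation `D`,
bound `max (θ₀ b + E) (2 (3/4)^K)`, provided `r + r' + ε ≤ D` (the peeled point does not see the
second cluster) and `E` dominates the coefficient errors `η(n, n − k)`, `k ≤ K`.
[cite: Ruelle1969, §4.2.2–4.2.3] -/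
theorem ksInv2_step {N n K : ℕ} {r r' D b E : ℝ} (hn1 : 1 ≤ n) (hn : n ≤ N + 1)
    (hεr : hsDiameter σ N ≤ r) (hr : 2 * r ≤ 1 / 4) (hb : 0 ≤ b)
    (hD : r + r' + hsDiameter σ N ≤ D)
    (hη : ∀ k, 1 ≤ k → k ≤ K → etaErr σ N n (n - k) ≤ E)
    (hI : ∀ (k k' : ℕ) (Y : Fin k → T3) (Y' : Fin k' → T3) (c c' : T3),
      (∀ a, Torus.euclidDist (Y a) c < 2 * r) → (∀ a, Torus.euclidDist (Y' a) c' < r') →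
      D - r ≤ Torus.euclidDist c c' →
      |vcan (hsDiameter σ N) (n - 1) (Fin.append Y Y') -
          gLim σ k (liftAt (hsDiameter σ N) c Y) * gLim σ k' (liftAt (hsDiameter σ N) c' Y')| ≤
        b * 4 ^ (k + k'))
    (hK : KSInv σ N n r' (max (thetaZero σ * b + E) (2 * (3 / 4) ^ K)))
    (k k' : ℕ) (Y : Fin k → T3) (Y' : Fin k' → T3) (c c' : T3)
    (hYc : ∀ a, Torus.euclidDist (Y a) c < r) (hY'c : ∀ a, Torus.euclidDist (Y' a) c' < r')
    (hcc : D ≤ Torus.euclidDist c c') :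
    |vcan (hsDiameter σ N) n (Fin.append Y Y') -
        gLim σ k (liftAt (hsDiameter σ N) c Y) * gLim σ k' (liftAt (hsDiameter σ N) c' Y')| ≤
      max (thetaZero σ * b + E) (2 * (3 / 4) ^ K) * 4 ^ (k + k') := by
  have hε : 0 < hsDiameter σ N := hsDiameter_pos h.σ_pos N
  have hε2 : hsDiameter σ N < 1 / 2 := by linarith
  have hΞn : 0 < XiT (hsDiameter σ N) n := XiT_pos h hn
  have hΞ : 0 < XiT (hsDiameter σ N) (n - 1) := XiT_pos h (by omega)
  have hmax0 : 0 ≤ max (thetaZero σ * b + E) (2 * (3 / 4) ^ K) :=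
    le_max_of_le_right (by positivity)
  have hG' : |gLim σ k' (liftAt (hsDiameter σ N) c' Y')| ≤ 3 ^ k' := abs_gLim_le h k' _
  obtain _ | k'' := k
  · -- `k = 0`: the one-cluster invariant of the second cluster
    rw [vcan_elim0_append, gLim_zero h, one_mul, zero_add]
    exact hK k' Y' c' hY'c
  rcases le_or_gt (k'' + 1 + k') K with hkK | hkK
  swap
  · -- `k + k' > K`: the trivial bound
    refine (abs_vcan_append_sub_mul_le_add h hn _ Y' _ _).trans ?_
    refine le_trans ?_ (mul_le_mul_of_nonneg_right (le_max_right _ _) (by positivity))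
    have h34 : (3 : ℝ) ^ (k'' + 1 + k') = (3 / 4) ^ (k'' + 1 + k') * 4 ^ (k'' + 1 + k') := by
      rw [← mul_pow]; norm_num
    have hKk : (3 / 4 : ℝ) ^ (k'' + 1 + k') ≤ (3 / 4) ^ K :=
      pow_le_pow_of_le_one (by norm_num) (by norm_num) hkK.le
    have h23 : (2 : ℝ) ^ (k'' + 1 + k') ≤ 3 ^ (k'' + 1 + k') :=
      pow_le_pow_left₀ (by norm_num) (by norm_num) _
    nlinarith [pow_pos (by norm_num : (0 : ℝ) < 4) (k'' + 1 + k')]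
  -- the main case `1 ≤ k + k' ≤ K`
  refine le_trans ?_ (mul_le_mul_of_nonneg_right (le_max_left _ _) (by positivity))
  obtain ⟨y₁, Y'', rfl⟩ : ∃ y₁ Y'', Y = Fin.cons y₁ Y'' :=
    ⟨Y 0, Fin.tail Y, (Fin.cons_self_tail Y).symm⟩
  have hy1c : Torus.euclidDist y₁ c < r := by simpa using hYc 0
  have hY''c : ∀ i, Torus.euclidDist (Y'' i) c < r := fun i => by simpa using hYc i.succ
  have hr0 : 0 < r := lt_of_lt_of_le hε hεr
  have hv₁ : 0 < v₁ := v₁_pos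
  -- geometry: the peeled point `y₁` is far from the second cluster
  have hcy1 : Torus.euclidDist c y₁ < r := by rw [Torus.euclidDist_comm]; exact hy1c
  have hy1c' : D - r ≤ Torus.euclidDist y₁ c' := by
    have := euclidDist_triangle c y₁ c'
    linarith
  have hsep : ∀ b', hsDiameter σ N ≤ Torus.euclidDist y₁ (Y' b') := by
    intro b'
    have h1 := euclidDist_triangle c y₁ c'
    have h2 := euclidDist_triangle y₁ (Y' b') c'
    have h3 := hY'c b'
    linarith
  rw [vcan_append_cons]
  -- notation
  set ε := hsDiameter σ N with hεdef
  set ρ := σ ^ 3 with hρ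
  set R := ratioLimit uniformProfile σ with hR
  set q := qN uniformProfile σ N (n - 1) with hq
  set κ := k'' + k' with hκ
  rw [show k'' + 1 + k' = κ + 1 by omega]
  set m := n - (κ + 1) with hm
  set W : Fin κ → T3 := Fin.append Y'' Y' with hW
  set x' : Fin k'' → E3 := liftAt ε y₁ Y'' with hx'
  set G' := gLim σ k' (liftAt ε c' Y') with hG'def
  set w := wallInd ε y₁ Y'' with hw
  have hq0 : 0 ≤ q := (qN_pos h.σ_pos.le h.σ_lt_half h.ovDensity_lt_one (by omega)).le
  have hq2 : q ≤ 2 := h.qN_le_two (by omega)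
  have hR0 : 0 ≤ R := h.ratioLimit_pos.le
  have hw01 : 0 ≤ w ∧ w ≤ 1 := ⟨(wallInd_mem_Icc ε y₁ Y'').1, (wallInd_mem_Icc ε y₁ Y'').2⟩
  have hwall : wallInd ε y₁ W = w := wallInd_append_of_le ε y₁ Y'' Y' hsep
  -- the two families of ball integrals
  set A : ℕ → ℝ := fun j => ∫ ζ : Fin j → E3, HardSphereKS.ballProd (0 : E3) ζ *
    vcan ε (n - 1) (Fin.append W (chartPts ε y₁ ζ)) with hA
  set B : ℕ → ℝ := fun j => ∫ ζ : Fin j → E3, HardSphereKS.ballProd (0 : E3) ζ *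
    gLim σ (k'' + j) (Fin.append x' ζ) with hB
  set α : ℕ → ℝ := fun j => q * ((-1 : ℝ) ^ j * (m.choose j : ℝ) * ε ^ (3 * j)) with hα
  set β : ℕ → ℝ := fun j => R * ((-ρ) ^ j / (Nat.factorial j : ℝ)) with hβ
  -- Step 1: the `v` side via the canonical KS identity and the chart
  have hv : vcan ε n (Fin.cons y₁ W) = w * ∑ j ∈ Finset.range (m + 1), α j * A j := by
    rw [vcan_cons ε hΞ hΞn y₁ W, ← qN_eq_XiT_div hn1 hn, hwall]
    have hch : ∀ j, ∫ z : Fin j → T3, ballInd ε y₁ z * vcan ε (n - 1) (Fin.append W z) =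
        ε ^ (3 * j) * A j := fun j =>
      integral_ballInd_mul_eq_pow_mul hε hε2 y₁
        (measurable_vcan_comp ε (n - 1) (measurable_append_right_T3 W))
    simp only [hch, Finset.mul_sum]
    refine Finset.sum_congr rfl fun j _ => ?_
    simp only [hα]; ring
  -- Step 2: the `g` side via the fixed-point equation
  have hbase : gLim σ (k'' + 1) (liftAt ε c (Fin.cons y₁ Y'')) =
      gLim σ (k'' + 1) (Fin.cons (0 : E3) x' : Fin (k'' + 1) → E3) := by
    have hY4 : ∀ a, Torus.euclidDist ((Fin.cons y₁ Y'' : Fin (k'' + 1) → T3) a) c < 1 / 4 :=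
      fun a => (hYc a).trans_le (by linarith)
    have e : liftAt ε y₁ (Fin.cons y₁ Y'') =
        fun a => -(ε⁻¹ • Torus.reprSym (y₁ - c)) + liftAt ε c (Fin.cons y₁ Y'') a :=
      funext fun a => liftAt_eq_add_liftAt hY4 (by simpa using hY4 0) a
    rw [← liftAt_cons ε y₁ Y'', e, gLim_const_add h]
  have hsumB : Summable fun j => (-ρ) ^ j / (Nat.factorial j : ℝ) * B j := by
    have := summable_ksTerm_gLim h k'' (Fin.cons (0 : E3) x' : Fin (k'' + 1) → E3)
    simp only [ksTerm_cons_zero] at this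
    exact this
  set T := ∑' j, (-ρ) ^ j / (Nat.factorial j : ℝ) * B j with hT
  have hg : gLim σ (k'' + 1) (Fin.cons (0 : E3) x' : Fin (k'' + 1) → E3) = R * w * T := by
    rw [gLim_succ h k'' (Fin.cons (0 : E3) x' : Fin (k'' + 1) → E3)]
    simp only [ksTerm_cons_zero]
    congr 1
    rw [hw, wallInd_eq_wall hε y₁ Y'', liftAt_cons]
  -- Step 3: the difference as one series
  have hS : HasSum (fun j => α j * A j) (∑ j ∈ Finset.range (m + 1), α j * A j) := by
    refine hasSum_sum_of_ne_finset_zero fun j hj => ?_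
    rw [Finset.mem_range, not_lt] at hj
    simp only [hα]
    rw [Nat.choose_eq_zero_of_lt (by omega)]
    simp
  have hT' : HasSum (fun j => β j * (B j * G')) (R * T * G') := by
    have e : (fun j => β j * (B j * G')) =
        fun j => R * ((-ρ) ^ j / (Nat.factorial j : ℝ) * B j) * G' := by
      funext j; simp only [hβ]; ring
    rw [e]
    exact (hsumB.hasSum.mul_left R).mul_right G'
  have hd : HasSum (fun j => α j * A j - β j * (B j * G'))
      ((∑ j ∈ Finset.range (m + 1), α j * A j) - R * T * G') := hS.sub hT'
  -- Step 4: termwise bounds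
  have hBb : ∀ j, |B j * G'| ≤ v₁ ^ j * 3 ^ (κ + j) := fun j => by
    have h1 : |B j| ≤ HardSphereKS.v1 E3 ^ j * 3 ^ (k'' + j) :=
      HardSphereKS.abs_integral_ballProd_mul_le (0 : E3) fun ζ => abs_gLim_le h _ _
    rw [v1_E3_eq] at h1
    rw [abs_mul, show (3 : ℝ) ^ (κ + j) = 3 ^ (k'' + j) * 3 ^ k' by rw [← pow_add]; congr 1; omega,
      ← mul_assoc]
    exact mul_le_mul h1 hG' (abs_nonneg _) (by positivity)
  have hAB : ∀ j, |A j - B j * G'| ≤ v₁ ^ j * (b * 4 ^ (κ + j)) := by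
    intro j
    have hintA : Integrable fun ζ : Fin j → E3 => HardSphereKS.ballProd (0 : E3) ζ *
        vcan ε (n - 1) (Fin.append W (chartPts ε y₁ ζ)) :=
      integrable_ballProd_mul (measurable_vcan_comp ε (n - 1)
        ((measurable_append_right_T3 W).comp (measurable_chartPts ε y₁ j)))
        (M := 2 ^ (κ + j)) fun ζ => abs_vcan_le h (by omega) _
    have hintB : Integrable fun ζ : Fin j → E3 => HardSphereKS.ballProd (0 : E3) ζ *
        (gLim σ (k'' + j) (Fin.append x' ζ) * G') :=
      integrable_ballProd_mul (((measurable_gLim h _).comp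
        (HardSphereKS.continuous_append_right x').measurable).mul_const _)
        (M := 3 ^ (k'' + j) * 3 ^ k') fun ζ => by
          rw [abs_mul]
          exact mul_le_mul (abs_gLim_le h _ _) hG' (abs_nonneg _) (by positivity)
    have hBG : B j * G' = ∫ ζ : Fin j → E3, HardSphereKS.ballProd (0 : E3) ζ *
        (gLim σ (k'' + j) (Fin.append x' ζ) * G') := by
      simp only [hB]
      rw [← integral_mul_const]
      refine integral_congr_ae (ae_of_all _ fun ζ => ?_)
      ring
    have hsub : A j - B j * G' = ∫ ζ : Fin j → E3, HardSphereKS.ballProd (0 : E3) ζ *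
        (vcan ε (n - 1) (Fin.append W (chartPts ε y₁ ζ)) -
          gLim σ (k'' + j) (Fin.append x' ζ) * G') := by
      rw [hBG]
      simp only [hA]
      rw [← integral_sub hintA hintB]
      refine integral_congr_ae (ae_of_all _ fun ζ => ?_)
      ring
    rw [hsub]
    refine abs_integral_ballProd_mul_le_of_ball (by positivity) fun ζ hζ => ?_
    -- the induction hypothesis at the appended configuration, centres `y₁`, `c'`
    have hwin : ∀ a, Torus.euclidDist (Fin.append Y'' (chartPts ε y₁ ζ) a) y₁ < 2 * r := by
      intro a
      refine Fin.addCases (fun i => ?_) (fun i => ?_) a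
      · rw [Fin.append_left]
        calc Torus.euclidDist (Y'' i) y₁ ≤ Torus.euclidDist (Y'' i) c + Torus.euclidDist c y₁ :=
              euclidDist_triangle _ _ _
          _ < r + r := add_lt_add (hY''c i) hcy1
          _ = 2 * r := by ring
      · rw [Fin.append_right]
        exact (euclidDist_chartPts_lt hε hε2 y₁ hζ i).trans_le (by linarith)
    have := hI (k'' + j) k' (Fin.append Y'' (chartPts ε y₁ ζ)) Y' y₁ c' hwin hY'c hy1c'
    rwa [liftAt_append, liftAt_chartPts hε hε2 y₁ hζ,
      ← vcan_append_append_swap ε (n - 1) Y'' Y' (chartPts ε y₁ ζ),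
      show (4 : ℝ) ^ (k'' + j + k') = 4 ^ (κ + j) by congr 1; omega] at this
  have habsα : ∀ j, |α j| = q * ((m.choose j : ℝ) * ε ^ (3 * j)) := fun j => by
    simp only [hα]
    rw [abs_mul, abs_mul, abs_mul, abs_pow, abs_pow, abs_neg, abs_one, one_pow, one_mul,
      Nat.abs_cast, abs_of_nonneg hq0, abs_of_pos hε]
  have hterm : ∀ j, ‖α j * A j - β j * (B j * G')‖ ≤
      q * ((m.choose j : ℝ) * ε ^ (3 * j)) * (v₁ ^ j * (b * 4 ^ (κ + j))) +
        (3 : ℝ) ^ κ * etaTerm σ N n m j := by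
    intro j
    rw [Real.norm_eq_abs]
    have e : α j * A j - β j * (B j * G') = α j * (A j - B j * G') + (α j - β j) * (B j * G') := by ring
    have hη' : |α j - β j| * |B j * G'| ≤ (3 : ℝ) ^ κ * etaTerm σ N n m j := by
      have : (3 : ℝ) ^ κ * etaTerm σ N n m j = |α j - β j| * (v₁ ^ j * 3 ^ (κ + j)) := by
        simp only [etaTerm, hα, hβ, hq, hR, hρ, hεdef, hm]; ring
      rw [this]
      exact mul_le_mul_of_nonneg_left (hBb j) (abs_nonneg _)
    rw [e]
    calc _ ≤ |α j * (A j - B j * G')| + |(α j - β j) * (B j * G')| := abs_add_le _ _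
      _ = |α j| * |A j - B j * G'| + |α j - β j| * |B j * G'| := by
          rw [abs_mul (α j) (A j - B j * G'), abs_mul (α j - β j) (B j * G')]
      _ ≤ _ := add_le_add (by rw [habsα]; exact mul_le_mul_of_nonneg_left (hAB j) (by positivity)) hη'
  -- Step 5: the majorant series
  have hM1 : HasSum (fun j => q * ((m.choose j : ℝ) * ε ^ (3 * j)) * (v₁ ^ j * (b * 4 ^ (κ + j))))
      (q * (b * 4 ^ κ) * (4 * v₁ * ε ^ 3 + 1) ^ m) := by
    have hfin : ∀ j ∉ Finset.range (m + 1),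
        q * ((m.choose j : ℝ) * ε ^ (3 * j)) * (v₁ ^ j * (b * 4 ^ (κ + j))) = 0 := by
      intro j hj
      rw [Finset.mem_range, not_lt] at hj
      rw [Nat.choose_eq_zero_of_lt (by omega)]
      simp
    have hs : HasSum (fun j => q * ((m.choose j : ℝ) * ε ^ (3 * j)) * (v₁ ^ j * (b * 4 ^ (κ + j))))
        (∑ j ∈ Finset.range (m + 1),
          q * ((m.choose j : ℝ) * ε ^ (3 * j)) * (v₁ ^ j * (b * 4 ^ (κ + j)))) :=
      hasSum_sum_of_ne_finset_zero hfin
    have e : ∑ j ∈ Finset.range (m + 1),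
        q * ((m.choose j : ℝ) * ε ^ (3 * j)) * (v₁ ^ j * (b * 4 ^ (κ + j))) =
          q * (b * 4 ^ κ) * (4 * v₁ * ε ^ 3 + 1) ^ m := by
      rw [add_pow, Finset.mul_sum]
      refine Finset.sum_congr rfl fun j _ => ?_
      ring
    rwa [e] at hs
  have hM2 : HasSum (fun j => (3 : ℝ) ^ κ * etaTerm σ N n m j) ((3 : ℝ) ^ κ * etaErr σ N n m) :=
    (summable_etaTerm σ N n m).hasSum.mul_left _
  have hmaj := hd.norm_le_of_bounded (hM1.add hM2) hterm
  rw [Real.norm_eq_abs] at hmaj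
  -- Step 6: the two constants
  have hpow : (4 * v₁ * ε ^ 3 + 1) ^ m ≤ Real.exp (4 * (v₁ * σ ^ 3)) := by
    have h1 : (4 * v₁ * ε ^ 3 + 1) ^ m ≤ Real.exp (4 * v₁ * ε ^ 3) ^ m :=
      pow_le_pow_left₀ (by positivity) (Real.add_one_le_exp _) m
    refine h1.trans ?_
    rw [← Real.exp_nat_mul, Real.exp_le_exp]
    have hm1 : (m : ℝ) ≤ (N + 1 : ℕ) := by exact_mod_cast (show m ≤ N + 1 by omega)
    have e := succ_mul_hsDiameter_pow_three σ N
    rw [← hεdef] at e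
    have := mul_le_mul_of_nonneg_right hm1 (by positivity : (0 : ℝ) ≤ 4 * v₁ * ε ^ 3)
    nlinarith
  have hT1 : q * (b * 4 ^ κ) * (4 * v₁ * ε ^ 3 + 1) ^ m ≤ thetaZero σ * b * 4 ^ (κ + 1) := by
    calc _ ≤ 2 * (b * 4 ^ κ) * Real.exp (4 * (v₁ * σ ^ 3)) :=
          mul_le_mul (mul_le_mul_of_nonneg_right hq2 (by positivity)) hpow (by positivity)
            (by positivity)
      _ = thetaZero σ * b * 4 ^ (κ + 1) := by rw [thetaZero, pow_succ]; ring
  have hT2 : (3 : ℝ) ^ κ * etaErr σ N n m ≤ E * 4 ^ (κ + 1) := by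
    have h34 : (3 : ℝ) ^ κ ≤ 4 ^ (κ + 1) :=
      (pow_le_pow_left₀ (by norm_num) (by norm_num) _).trans
        (pow_le_pow_right₀ (by norm_num) (Nat.le_succ _))
    calc _ ≤ (4 : ℝ) ^ (κ + 1) * E :=
          mul_le_mul h34 (hη (κ + 1) le_add_self (by omega)) (etaErr_nonneg _ _ _ _) (by positivity)
      _ = E * 4 ^ (κ + 1) := mul_comm _ _
  -- Step 7: assemble
  rw [hbase, hv, hg, show w * (∑ j ∈ Finset.range (m + 1), α j * A j) - R * w * T * G' =
    w * ((∑ j ∈ Finset.range (m + 1), α j * A j) - R * T * G') by ring, abs_mul, abs_of_nonneg hw01.1]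
  calc _ ≤ 1 * |(∑ j ∈ Finset.range (m + 1), α j * A j) - R * T * G'| :=
        mul_le_mul_of_nonneg_right hw01.2 (abs_nonneg _)
    _ ≤ _ := by rw [one_mul]; exact hmaj.trans (by linarith)

end Step

end Literature.MathematicalPhysics.KineticTheory
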